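import Literature.AnabelianGeometry.SemiGraphs.TemperedAnabelianThm64SubProofs
import Literature.AnabelianGeometry.SemiGraphs.TemperedAnabelianWitness

/-!
# [SemiAnbd] Thm. 6.4 sub-DAG: rows T64-L06′ / T64-L07 when `Π^temp ↪ Π` is onto, and at the degenerate inhabitant

S. Mochizuki, *Semi-graphs of anabelioids*, Publ. RIMS **42** (2006) [SemiAnbd], §6: Lemma 6.3 (iii)
(kurims p. 70: "Suppose that `F₁, F₂ ⊆ F` are subgroups of DOF-type which are dense in `F̂`. Then, for
any `f ∈ F̂` such that `f · F₁ · f⁻¹ = F₂`, it follows that `f ∈ F`") and the last inference of the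
proof of Theorem 6.4 (p. 71: "by Lemma 6.3, (iii), we thus conclude that `φ` differs from `ψ` by
composition with an inner automorphism of `Π^temp_{Y_L}`").
[cite: MochizukiSemiAnbd2006, Lem 6.3(iii) p.70, Thm 6.4 proof p.71]

PROOF-ONLY companion (theorems only; no definition, no new fact) of `TemperedAnabelianThm64Sub.lean`
(abc-iut-w5-d139) for the two rows of the frozen FACT-LIST that the tranche-170 file
`TemperedAnabelianThm64SubSchemas.lean` (abc-iut-w4-d025) deliberately left open:
F-2837 `TemperedCurve.OpenDenseDOFConjugator` (T64-L06′ = Lemma 6.3 (iii) at the finite étale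
coverings) and F-2838 `TemperedCurve.OuterDescent` (T64-L07).  Cell abc-iut, seat abc-iut-w4-d076
(director-abc (C3) default duty, FACT-LIST proving).

What is proved, over the interface `TemperedCurve p` of `TemperedAnabelian.lean`:

* `openDenseDOFConjugator_of_toHat_surjective`, `outerDescent_of_toHat_surjective` — a SUFFICIENT
  CONDITION at the interface level: if the natural injection `Π^temp_{Y_L} ↪ Π_{Y_L}` is onto (i.e.
  `Π^temp_{Y_L}` is already its own profinite completion), both rows hold for `Y` (and every `X`).
  The first is the classical fact that an open subgroup of finite index `U` is recovered from the
  closure of its image, `ι⁻¹(Û) = U` (`IsProfiniteCompletion.mem_of_map_mem_closure`, abc-iut-w5-d139);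
  the second is immediate from the injectivity of `ι`.
* `openDenseDOFConjugator_degenerate`, `outerDescent_degenerate` — hence both rows HOLD at the
  interface's degenerate inhabitant `TemperedCurve.degenerate p` (`TemperedAnabelianWitness.lean`,
  abc-iut-c312-4: `Π^temp := G_{ℚ_p}` with the identity as completion map), i.e. the FACT-LIST reading
  "instance form MODEL-WITNESSED" for F-2837 / F-2838: the hypotheses `h06` of
  `temperedAnabelianTheorem_of_inputs` and `h07` of `temperedAnabelianTheorem_of_steps` are satisfiable
  together with the interface axioms.
* `temperedAnabelianTheorem_of_inputs_of_toHat_surjective` — the sharpened assembly with T64-L06′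
  discharged in that case.

HONEST LIMITS.  The intended `Π^temp_{Y_L}` (André's tempered fundamental group) is never compact, so
the sufficient condition is a CONSISTENCY statement about the interface, not a proof of Lemma 6.3 (iii)
for hyperbolic curves; at the cell's non-compact inhabitant `EtaleTheta.SettingModel.curve p`
(`Π^tp = F₂ × Γ` discrete) the rows reduce to normaliser statements in profinite completions of
DISCRETE groups (the free factor is [SemiAnbd] Lem. 6.1 (i) at finite-index subgroups; the `Γ`-factor
concerns the abstract group `G_{ℚ_p}`), treated separately.  Nothing of [SemiAnbd] is asserted or
denied; nothing here takes a side on [IUTchIII] Cor. 3.12.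
-/

noncomputable section

namespace Literature.AnabelianGeometry.SemiGraphs

namespace TemperedCurve

variable {p : ℕ} [Fact p.Prime]

/-! ### The case `Π^temp ↪ Π` onto -/

/-- **T64-L06′ when `ι : Π^temp_{Y_L} → Π_{Y_L}` is onto.**  For an open subgroup `U` of finite index,
`ι⁻¹(closure ι(U)) = U` (classical, over `IsProfiniteCompletion`); so if every `c ∈ Π_{Y_L}` is an
`ι y`, a `c` in the closure of `ι(U)` already lies in `ι(U)` — whatever the dense DOF subgroups
`F₁, F₂` are. [cite: MochizukiSemiAnbd2006, Lem 6.3(iii) p.70] -/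
theorem openDenseDOFConjugator_of_toHat_surjective (Y : TemperedCurve p)
    (hsurj : Function.Surjective Y.toHat) : Y.OpenDenseDOFConjugator := by
  intro U hUo hUfi F₁ F₂ _ _ _ _ _ _ c hc _
  haveI := hUfi
  obtain ⟨y, rfl⟩ := hsurj c
  exact ⟨y, IsProfiniteCompletion.mem_of_map_mem_closure Y.isProfiniteCompletion_toHat U hUo hc, rfl⟩

/-- **T64-L07 when `ι : Π^temp_{Y_L} → Π_{Y_L}` is onto.**  If `ι ∘ φ = Inn(c) ∘ ι ∘ ψ` with `c = ι y`,
then `φ = Inn(y) ∘ ψ` by the injectivity of `ι` ("natural injection", [SemiAnbd] p. 69).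
[cite: MochizukiSemiAnbd2006, Thm 6.4 proof p.71] -/
theorem outerDescent_of_toHat_surjective (X Y : TemperedCurve p)
    (hsurj : Function.Surjective Y.toHat) : OuterDescent X Y := by
  intro φ ψ _ _ hc
  obtain ⟨c, hc⟩ := hc
  obtain ⟨y, rfl⟩ := hsurj c
  refine ⟨y, fun x => Y.toHat_injective ?_⟩
  rw [hc x, map_mul, map_mul, map_inv]

/-- The sharpened assembly of [SemiAnbd] Thm. 6.4 (`temperedAnabelianTheorem_of_inputs`,
abc-iut-w5-d139) with the input T64-L06′ DISCHARGED in the case `Π^temp_{Y_L} ↪ Π_{Y_L}` onto: the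
typed node follows from T64-L01, T64-L01b, T64-L02 (Lemma 6.3 (ii)) and T64-L04 ([Mzk8] Thm. 1.2)
alone.  (Hypotheses by name; typed ≠ proved.) [cite: MochizukiSemiAnbd2006, Thm 6.4 pp.70-71] -/
theorem temperedAnabelianTheorem_of_inputs_of_toHat_surjective {X Y : TemperedCurve p}
    (C : TemperedCurveHom p X Y) (hsurj : Function.Surjective Y.toHat)
    (h01 : GeometricIsDFG C) (h01b : GeometricIsGaloisCompatible C) (h02 : Y.PiTempDFGIffDOF)
    (h04 : ProfiniteAnabelianTheorem C) : TemperedAnabelianTheorem C :=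
  temperedAnabelianTheorem_of_inputs C h01 h01b h02 h04
    (openDenseDOFConjugator_of_toHat_surjective Y hsurj)

/-! ### The degenerate inhabitant `TemperedCurve.degenerate p` (`Π^temp := G_{ℚ_p}`, `ι = id`) -/

/-- At the degenerate inhabitant the completion map is the identity, hence onto.
[cite: MochizukiSemiAnbd2006, §6 p.69] -/
theorem toHat_surjective_degenerate (p : ℕ) [Fact p.Prime] :
    Function.Surjective (TemperedCurve.degenerate p).toHat :=
  Function.surjective_id

/-- **F-2837 / T64-L06′ MODEL-WITNESSED**: Lemma 6.3 (iii) at the coverings holds at the degenerate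
inhabitant of `TemperedCurve p`. Consistency evidence for the hypothesis `h06` of
`temperedAnabelianTheorem_of_inputs`; not a statement about hyperbolic curves.
[cite: MochizukiSemiAnbd2006, Lem 6.3(iii) p.70] -/
theorem openDenseDOFConjugator_degenerate (p : ℕ) [Fact p.Prime] :
    (TemperedCurve.degenerate p).OpenDenseDOFConjugator :=
  openDenseDOFConjugator_of_toHat_surjective _ (toHat_surjective_degenerate p)

/-- **F-2838 / T64-L07 MODEL-WITNESSED**: the descent of `Π_{Y_L}`-conjugacy of DOF-type
homomorphisms to `Π^temp_{Y_L}`-conjugacy holds for every `X` when `Y` is the degenerate inhabitant.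
Consistency evidence for the hypothesis `h07` of `temperedAnabelianTheorem_of_steps`.
[cite: MochizukiSemiAnbd2006, Thm 6.4 proof p.71] -/
theorem outerDescent_degenerate (p : ℕ) [Fact p.Prime] (X : TemperedCurve p) :
    OuterDescent X (TemperedCurve.degenerate p) :=
  outerDescent_of_toHat_surjective X _ (toHat_surjective_degenerate p)

/-- Both rows are jointly satisfiable with the interface axioms: there is a datum of `TemperedCurve p`
at which T64-L06′ holds and T64-L07 holds against every source `X`.
[cite: MochizukiSemiAnbd2006, Thm 6.4 proof p.71] -/
theorem exists_openDenseDOFConjugator_and_outerDescent (p : ℕ) [Fact p.Prime] :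
    ∃ Y : TemperedCurve p, Y.OpenDenseDOFConjugator ∧ ∀ X : TemperedCurve p, OuterDescent X Y :=
  ⟨TemperedCurve.degenerate p, openDenseDOFConjugator_degenerate p, outerDescent_degenerate p⟩

end TemperedCurve

end Literature.AnabelianGeometry.SemiGraphs

end
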